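import Literature.NumberTheory.LFunctions.Zhang2022.DetectorShiftPSDOffBox
import Literature.NumberTheory.LFunctions.Zhang2022.DetectorShiftPinnedModesPoints

/-!
# Zhang (2022) detector main-term forms — the PSD half of the slot-region criterion as a KERNEL SCHEMA for every shift
# triple: «one negative lattice mode with pin index ≤ 0 ⇒ the one-sided and the glued slots HOLD», and the finitary
# trichotomy `FormDetPSD (shiftRecipe b) ↔ GluedFormPSD b ↔ [no negative mode] ∨ [one negative mode ∧ pin index ≤ 0]`

Y. Zhang, *Discrete mean estimates and the Landau–Siegel zero*, arXiv:2211.02515v1 (2022) [Zhang2022LandauSiegel] —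
an unrefereed manuscript under adjudication. **WHAT THIS IS NOT: a claim about its Theorems 1–2, about Landau–Siegel
zeros, about Parity, or about a repaired `Margin232`. The programme SEARCHES and TYPES; no claim about Landau–Siegel
zeros, Theorems 1–2 of arXiv:2211.02515 or a repaired Margin232 until a kernel theorem says so.**

Cell landau-siegel §E (ls-barrier-p5 g6), KNIFE-EDGES K11 / BARRIER-STATE §2′ N6 (ii): the desk criterion of
HOME/barrier/p5/GLUED-SLOT-REGION.md §1 («for sorted `0 < b₀ < b₁ < b₂` with `c₀(b) > 0`:
`FormDetPSD (shiftRecipe b) ⟺ GluedFormPSD b ⟺ N(b) = 0 ∨ (N(b) = 1 ∧ S(b) ≤ 0)`») in FINITARY form, both halves kernel: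

* `Det.exists_majorant_of_pin_index` — the finitary pin-index bound «`|σ_b(m₀)|·Σ_{m∈t} m²/σ_b(m) ≤ m₀²` for every finite
  set `t` of modes off `{0, m₀}`» yields the summable majorant with (non-strict) slack that the engine
  `Det.bulkFormOn_periodic_two_piece_nonneg_of_pin` (`DetectorShiftPSDOffBox`, Part 2) consumes (Mathlib `summable_of_sum_le`).
* **`Det.formDetPSD_shiftRecipe_of_pin_index`** — injective `b`, `c₀(b) > 0`, ONE negative mode `m₀`, every other non-zero
  mode positive, finitary pin index `≤ 0` ⇒ `FormDetPSD (shiftRecipe b)`: the EXACT CONVERSE of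
  `Det.not_formDetPSD_of_pin_excess` (`DetectorShiftPinnedModes`, ls-barrier-p6 g5) in the same currency (no `tsum`, no
  cotangent closed form, no certificate); the boundary case «pin index `= 0`» is included.
* **`Det.gluedFormPSD_of_pin_index`** — the same for Family B's no-overlap glued slot (`b_j ≠ 0`), engine
  `Det.formDetGlued_nonneg_of_twoPointArc_pin` (`DetectorShiftPSDOffBox`, Part 4).
* `Det.formDetPSD_shiftRecipe_iff_pin_index`, `Det.gluedFormPSD_iff_pin_index`, `Det.gluedFormPSD_iff_formDetPSD_of_one_mode`
  — the «N = 1 shell» as kernel IFFs (→ by ls-barrier-p6's clause, cited by name).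
* **`Det.formDetPSD_shiftRecipe_iff_modes`**, **`Det.gluedFormPSD_iff_modes`**, **`Det.gluedFormPSD_iff_formDetPSD`** — for
  every SORTED POSITIVE triple with `c₀(b) > 0`: the slot holds iff [every lattice mode is `≥ 0`] (= Lemma 2.3's box,
  `Det.signAdmissible_iff_latticeSymbol_nonneg`, K5/K6 `Det.formDetPSD_shiftRecipe_of_signAdmissible`,
  `Det.gluedFormPSD_of_signAdmissible`) or [exactly one negative mode, all other non-zero modes positive, finitary pin
  index `≤ 0`]; `N ≥ 2` and «one negative + one zero mode» fail by `Det.not_formDetPSD_of_two_modes`. Hence the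
  one-sided E-010 slot region EQUALS the no-overlap glued slot region on `{c₀ > 0}` (both ⊋ the box = the windowed region, K8).

The three slots of the convention of record: ONE-SIDED `Det.FormDetPSD (Det.shiftRecipe b)` (E-010, row 17), GLUED
`Det.GluedFormPSD b` (Family B, row 57), WINDOWED `Det.DictShiftPSD b` (Family A) — the windowed slot is NOT touched here
(it stays K6/K8: `Det.dictShiftPSD_iff_signAdmissible`, the box). «No zero mode» in the one-negative-mode hypotheses is
sharp, not a convenience: a zero mode `m₂ ≠ 0` next to a negative mode FAILS the slot (`Det.not_formDetPSD_of_two_modes`);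
in the «no negative mode» branch zero modes are allowed (`b = (1,2,3)` has `σ(−1) = σ(−2) = σ(−3) = 0`). This file does
NOT evaluate the pin index: the closed form `S(b) = −π·Σ_j b_j cot(πb_j)/v_j(b)` and the census values stay DESK /
certified (HOME/barrier/p5/GLUED-SLOT-REGION.md §3–§5, kit j270198 / j270586); no number beyond in-kernel rationals enters.

Taxonomy of the main-term quadratic form only: no coverage row, no word, no displayed premise of the class of record
depends on it. The named instances `Det.formDetPSD_shiftRecipe_offBoxTriple` / `Det.gluedFormPSD_offBoxTriple`
(`b♭ = (1/2, 5/2, 13/4)`, `Det.offBoxTriple_three_slots`) and the six census FAIL points of `DetectorShiftPinnedModesPoints`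
are this criterion's first kernel points (cited, not restated).

References: Y. Zhang, arXiv:2211.02515v1 (2022), §2 Lemma 2.3, Prop. 7.1 p.44 with (7.2), §8 (8.11)–(8.23), §12
(12.6)–(12.8), §18 (18.1); Y. Katznelson, *An introduction to harmonic analysis* (2004), Ch. I §5 [Katznelson2004].
[cite: Zhang2022LandauSiegel, §2 Lemma 2.3; Prop 7.1 p.44 with (7.2), (8.11)–(8.23)]
-/

noncomputable section

open Complex Real Set Filter Topology Finset
open scoped ComplexConjugate
open intervalIntegral
open _root_.MeasureTheory

namespace Literature.NumberTheory.LFunctions.Zhang2022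

namespace Det

/-! ### Part 1 — from the finitary pin-index bound to the summable majorant with slack -/

section Majorant

variable {b : Fin 3 → ℝ}

/-- A negative lattice mode is non-zero (`σ_b(0) = 0`). [cite: Zhang2022LandauSiegel, Prop 7.1 (8.11)–(8.23)] -/
theorem ne_zero_of_latticeSymbol_neg {m₀ : ℤ} (h₀ : latticeSymbol b m₀ < 0) : m₀ ≠ 0 := by
  rintro rfl
  rw [latticeSymbol_zero] at h₀
  exact lt_irrefl _ h₀

/-- **Finitary pin index `≤ 0` ⇒ a summable majorant with slack.** If `σ_b(m₀) < 0`, every other non-zero mode is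
positive and `|σ_b(m₀)|·Σ_{m∈t} m²/σ_b(m) ≤ m₀²` for every finite set `t` of modes off `{0, m₀}`, then the pin terms
`G(m) = m²/σ_b(m)` (extended by `0` on `{0, m₀}`) are non-negative, summable (bounded partial sums, Mathlib
`summable_of_sum_le`) and `(Σ G)·|σ_b(m₀)| ≤ m₀²` — exactly the majorant data of
`Det.bulkFormOn_periodic_two_piece_nonneg_of_pin`. [cite: Zhang2022LandauSiegel, Prop 7.1 (8.11)–(8.23)] -/
theorem exists_majorant_of_pin_index {m₀ : ℤ} (h₀ : latticeSymbol b m₀ < 0)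
    (hpos : ∀ m : ℤ, m ≠ 0 → m ≠ m₀ → 0 < latticeSymbol b m)
    (hS : ∀ t : Finset ℤ, (∀ m ∈ t, m ≠ 0 ∧ m ≠ m₀) →
      |latticeSymbol b m₀| * ∑ m ∈ t, (m : ℝ) ^ 2 / latticeSymbol b m ≤ (m₀ : ℝ) ^ 2) :
    ∃ (G : ℤ → ℝ) (R₀ : ℝ), (∀ m : ℤ, m ≠ 0 → m ≠ m₀ → (m : ℝ) ^ 2 / latticeSymbol b m ≤ G m) ∧
      (∀ m, 0 ≤ G m) ∧ HasSum G R₀ ∧ R₀ * |latticeSymbol b m₀| ≤ (m₀ : ℝ) ^ 2 := by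
  classical
  set G : ℤ → ℝ := fun m => if m = 0 ∨ m = m₀ then 0 else (m : ℝ) ^ 2 / latticeSymbol b m with hG
  have hGoff : ∀ m : ℤ, m ≠ 0 → m ≠ m₀ → G m = (m : ℝ) ^ 2 / latticeSymbol b m := fun m hm hm₀ => by
    simp only [hG, if_neg (not_or.2 ⟨hm, hm₀⟩)]
  have hGon : ∀ m : ℤ, (m = 0 ∨ m = m₀) → G m = 0 := fun m hm => by
    simp only [hG, if_pos hm]
  have hG0 : ∀ m, 0 ≤ G m := by
    intro m
    by_cases hm : m = 0 ∨ m = m₀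
    · rw [hGon m hm]
    · obtain ⟨h1, h2⟩ := not_or.1 hm
      rw [hGoff m h1 h2]
      exact div_nonneg (sq_nonneg _) (hpos m h1 h2).le
  have hσ₀ : 0 < |latticeSymbol b m₀| := abs_pos.2 h₀.ne
  -- every finite partial sum of `G` is bounded by `m₀²/|σ_b(m₀)|`
  have hbd : ∀ t : Finset ℤ, ∑ m ∈ t, G m ≤ (m₀ : ℝ) ^ 2 / |latticeSymbol b m₀| := by
    intro t
    set t' : Finset ℤ := t.filter (fun m => ¬ (m = 0 ∨ m = m₀)) with ht'
    have hsplit : ∑ m ∈ t, G m = ∑ m ∈ t', (m : ℝ) ^ 2 / latticeSymbol b m := by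
      rw [ht', Finset.sum_filter]
      refine Finset.sum_congr rfl fun m _ => ?_
      by_cases hm : m = 0 ∨ m = m₀
      · rw [if_neg (not_not.2 hm), hGon m hm]
      · obtain ⟨h1, h2⟩ := not_or.1 hm
        rw [if_pos hm, hGoff m h1 h2]
    have hmem : ∀ m ∈ t', m ≠ 0 ∧ m ≠ m₀ := fun m hm => by
      rw [ht', Finset.mem_filter] at hm
      exact not_or.1 hm.2
    have h := hS t' hmem
    rw [hsplit, le_div_iff₀ hσ₀]
    linarith
  have hsum : Summable G := summable_of_sum_le hG0 hbd
  refine ⟨G, ∑' m, G m, fun m hm hm₀ => (hGoff m hm hm₀).symm.le, hG0, hsum.hasSum, ?_⟩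
  have htsum : ∑' m, G m ≤ (m₀ : ℝ) ^ 2 / |latticeSymbol b m₀| := hsum.tsum_le_of_sum_le hbd
  calc (∑' m, G m) * |latticeSymbol b m₀| ≤ (m₀ : ℝ) ^ 2 / |latticeSymbol b m₀| * |latticeSymbol b m₀| :=
        mul_le_mul_of_nonneg_right htsum hσ₀.le
    _ = (m₀ : ℝ) ^ 2 := div_mul_cancel₀ _ hσ₀.ne'

end Majorant

/-! ### Part 2 — the PSD schema for the one-sided slot and for the glued slot -/

section Schema

variable {b : Fin 3 → ℝ}

/-- Continuity transported along `y ↦ y + 1`. [folklore] -/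
private theorem continuousOn_translate_one₃ {F : ℝ → ℂ} (hF : ContinuousOn F (Icc 0 1)) :
    ContinuousOn (fun y : ℝ => F (y + 1)) (Icc (-1:ℝ) 0) :=
  hF.comp (continuous_id.add continuous_const).continuousOn fun y hy => ⟨by linarith [hy.1], by linarith [hy.2]⟩

/-- Right-derivatives transported along `y ↦ y + 1`. [folklore] -/
private theorem hasDerivWithinAt_translate_one₃ {F F' : ℝ → ℂ}
    (hd : ∀ y ∈ Ioo (0:ℝ) 1, HasDerivWithinAt F (F' y) (Ioi y) y) {y : ℝ} (hy : y ∈ Ioo (-1:ℝ) 0) :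
    HasDerivWithinAt (fun z : ℝ => F (z + 1)) (F' (y + 1)) (Ioi y) y := by
  have hy' : y + 1 ∈ Ioo (0:ℝ) 1 := ⟨by linarith [hy.1], by linarith [hy.2]⟩
  have h := hd (y + 1) hy'
  have h2 : HasDerivWithinAt (fun t : ℝ => t + 1) (1:ℝ) (Ioi y) y := (hasDerivAt_id y).add_const 1 |>.hasDerivWithinAt
  have := h.scomp y h2 (fun t ht => by simpa using ht)
  rw [Function.comp_def] at this
  simpa using this

/-- **THE PSD SCHEMA FOR THE ONE-SIDED E-010 SLOT (K11, positive half, every triple).** Let `b` be pairwise distinct with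
`c₀(b) = Re Σ_j W_j(b) > 0`; suppose the lattice symbol `σ_b` has ONE negative mode `m₀`, is positive at every other
non-zero mode (i.e. exactly one negative mode AND no zero mode off `0` — sharp: a zero mode `m₂ = −b_j ≠ 0` beside `m₀`
FAILS the slot by `Det.not_formDetPSD_of_two_modes`), and the finitary pin index is `≤ 0`:
`|σ_b(m₀)|·Σ_{m∈t} m²/σ_b(m) ≤ m₀²` for every finite set `t` of modes off `{0, m₀}` (boundary `= m₀²` allowed). Then
`Det.FormDetPSD (Det.shiftRecipe b)`: for every one-sided kinked `g` with `g(1) = 0`, [K1]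
`(π/2)𝔅 = c₀T^{[0,1]}(S) + F_b(∫g, −g0)`, [K2″] the free-end form is `c₀T^{[0,1]}(E)` of the two-point extremal with far
jets `0`, and the periodic two-piece form `E(·+1) ⊕ S` is pinned at `y = 1`, so `bulkFormOn_periodic_two_piece_nonneg_of_pin`
applies with the majorant of `exists_majorant_of_pin_index`. The exact converse of `Det.not_formDetPSD_of_pin_excess`.
[cite: Zhang2022LandauSiegel, §2 Lemma 2.3; Prop 7.1 p.44 with (7.2), (8.11)–(8.23)] -/
theorem formDetPSD_shiftRecipe_of_pin_index (hb : Function.Injective b) (hc : 0 < (∑ j : Fin 3, shiftW b j).re)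
    {m₀ : ℤ} (h₀ : latticeSymbol b m₀ < 0) (hpos : ∀ m : ℤ, m ≠ 0 → m ≠ m₀ → 0 < latticeSymbol b m)
    (hS : ∀ t : Finset ℤ, (∀ m ∈ t, m ≠ 0 ∧ m ≠ m₀) →
      |latticeSymbol b m₀| * ∑ m ∈ t, (m : ℝ) ^ 2 / latticeSymbol b m ≤ (m₀ : ℝ) ^ 2) :
    FormDetPSD (shiftRecipe b) := by
  obtain ⟨G, R₀, hG, hG0, hGsum, hslack⟩ := exists_majorant_of_pin_index h₀ hpos hS
  have hm₀ : m₀ ≠ 0 := ne_zero_of_latticeSymbol_neg h₀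
  intro g g' hg hg1
  have h01 : b 0 ≠ b 1 := fun h => absurd (hb h) (by decide)
  have h02 : b 0 ≠ b 2 := fun h => absurd (hb h) (by decide)
  have h12 : b 1 ≠ b 2 := fun h => absurd (hb h) (by decide)
  -- [K1]
  have hK1 := formDet_shiftRecipe_eq_bulk_add_freeEnd hb hg hg1
  -- [K2″] with zero far jets
  obtain ⟨E, E', E'', hEc, hEc', hEc'', hd, hd', hE0, hE0', hE1, hE1', hid⟩ :=
    twoPoint_pieces b h01 h02 h12 hc.ne' (∫ y in (0:ℝ)..1, g y) (-g 0) 0 0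
  have hF00 : freeEndForm b 0 0 = 0 := by simp [freeEndForm]
  have hglue0 : twoPointGlue b (∫ y in (0:ℝ)..1, g y) (-g 0) 0 0 = 0 := by simp [twoPointGlue]
  rw [hF00, hglue0, add_zero, Complex.zero_re, mul_zero, add_zero] at hid
  simp only [map_zero, neg_zero] at hE0 hE0'
  -- the right piece `S = tailPrim g`
  obtain ⟨hSc, hS'c, hSd, hS'd, hS''m, hS1, hg1'⟩ := rightPiece_of_kinked hg hg1
  have i'' : IntervalIntegrable (fun y => -g' y) volume 0 1 := intervalIntegrable_of_memLp_Ioc zero_le_one hS''m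
  have hRibp : ∀ m : ℤ, dpiece 0 1 (fun y => -g' y) m
      = (fun y => -g y) 1 * cexp (-(I * π * m * ((1:ℝ) : ℂ))) - (fun y => -g y) 0 * cexp (-(I * π * m * ((0:ℝ) : ℂ)))
        + I * π * m * dpiece 0 1 (fun y => -g y) m :=
    fun m => dpiece_deriv zero_le_one hS'c hS'd i'' m
  -- the pinned periodic two-piece inequality
  have hcell := bulkFormOn_periodic_two_piece_nonneg_of_pin (b := b) hm₀ h₀ hpos hG hG0 hGsum hslack
    (L := fun y => E (y + 1)) (L' := fun y => E' (y + 1)) (L'' := fun y => E'' (y + 1))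
    (R := tailPrim g) (R' := fun y => -g y) (R'' := fun y => -g' y)
    (continuousOn_translate_one₃ hEc) (continuousOn_translate_one₃ hEc')
    (memLp_two_of_continuousOn_Icc' (continuousOn_translate_one₃ hEc''))
    (fun y hy => hasDerivWithinAt_translate_one₃ hd hy) (fun y hy => hasDerivWithinAt_translate_one₃ hd' hy)
    hSc hS'c hS''m hSd hRibp
    (by simp only [zero_add, hE1, tailPrim_zero])
    (by simp only [zero_add, hE1'])
    (by simp only [neg_add_cancel, hE0, tailPrim_one])
    (by simp only [neg_add_cancel, hE0', hg1, neg_zero])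
    (by simp only [hg1, neg_zero])
  rw [bulkFormOn_comp_add_one] at hcell
  -- assemble
  have key : π / 2 * FormDet (shiftRecipe b) g g'
      = (∑ j : Fin 3, shiftW b j).re * (bulkFormOn b 0 1 E E' E''
          + bulkFormOn b 0 1 (tailPrim g) (fun y => -g y) (fun y => -g' y)) := by
    rw [hK1, ← hid]; ring
  have hπ : 0 < π / 2 := by positivity
  exact (mul_nonneg_iff_of_pos_left hπ).1 (key ▸ mul_nonneg hc.le hcell)

/-- **THE PSD SCHEMA FOR THE NO-OVERLAP GLUED SLOT (Family B, row 57's slot).** Same hypotheses on `σ_b` plus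
`b_j ≠ 0` ⇒ `Det.GluedFormPSD b`: [K1″] `formDetGlued_eq_bulk_add` + [K2″] `twoPoint_pieces` + `twoPointGlue_eq_F0DetC` +
`formDetGlued_nonneg_of_twoPointArc_pin` (the circle function is pinned at the split point) with the majorant of
`exists_majorant_of_pin_index`. The exact converse of `Det.not_gluedFormPSD_of_pin_excess`.
[cite: Zhang2022LandauSiegel, Prop 7.1 p.44 with (7.2), (8.11)–(8.23); §12 (12.6)–(12.8); §18 (18.1)] -/
theorem gluedFormPSD_of_pin_index (hb : Function.Injective b) (hb0 : ∀ j, b j ≠ 0)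
    (hc : 0 < (∑ j : Fin 3, shiftW b j).re)
    {m₀ : ℤ} (h₀ : latticeSymbol b m₀ < 0) (hpos : ∀ m : ℤ, m ≠ 0 → m ≠ m₀ → 0 < latticeSymbol b m)
    (hS : ∀ t : Finset ℤ, (∀ m ∈ t, m ≠ 0 ∧ m ≠ m₀) →
      |latticeSymbol b m₀| * ∑ m ∈ t, (m : ℝ) ^ 2 / latticeSymbol b m ≤ (m₀ : ℝ) ^ 2) :
    GluedFormPSD b := by
  obtain ⟨G, R₀, hG, hG0, hGsum, hslack⟩ := exists_majorant_of_pin_index h₀ hpos hS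
  have hm₀ : m₀ ≠ 0 := ne_zero_of_latticeSymbol_neg h₀
  intro u u' v v' h
  obtain ⟨t₁, t₂, ht₁, ht₂, ht, hu, hv⟩ := h.sep
  have h01 : b 0 ≠ b 1 := fun h => absurd (hb h) (by decide)
  have h02 : b 0 ≠ b 2 := fun h => absurd (hb h) (by decide)
  have h12 : b 1 ≠ b 2 := fun h => absurd (hb h) (by decide)
  obtain ⟨E, E', E'', hEc, hEc', hEc'', hd, hd', e0, e0', e1, e1', hid⟩ :=
    twoPoint_pieces b h01 h02 h12 hc.ne' (∫ y in (0:ℝ)..1, u y) (-u 0) (∫ y in (0:ℝ)..1, v y) (-v 0)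
  rw [twoPointGlue_eq_F0DetC (hb0 0) (hb0 1) (hb0 2)] at hid
  rw [map_neg] at e0'
  rw [neg_neg, neg_neg] at hid
  exact formDetGlued_nonneg_of_twoPointArc_pin (b := b) hm₀ h₀ hpos hG hG0 hGsum hslack
    hb hc h.kinked₁ h.kinked₂ ht₁ ht₂ ht (fun y hy => hu y hy.1) (fun y hy => hv y hy.1)
    hEc hEc' hEc'' hd hd' e0 e0' e1 e1' hid

/-! ### Part 3 — the «N = 1 shell» as kernel IFFs (→ by ls-barrier-p6's pin-excess clause) -/

/-- **The one-sided slot on the one-negative-mode stratum, IFF form.** For pairwise-distinct `b` with `c₀(b) > 0`, one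
negative mode `m₀` and all other non-zero modes positive:
`FormDetPSD (shiftRecipe b) ↔ ∀ finite t off {0, m₀}, |σ_b(m₀)|·Σ_{m∈t} m²/σ_b(m) ≤ m₀²` (← `formDetPSD_shiftRecipe_of_pin_index`,
→ `Det.not_formDetPSD_of_pin_excess`). [cite: Zhang2022LandauSiegel, §2 Lemma 2.3; Prop 7.1 p.44 with (7.2), (8.11)–(8.23)] -/
theorem formDetPSD_shiftRecipe_iff_pin_index (hb : Function.Injective b) (hc : 0 < (∑ j : Fin 3, shiftW b j).re)
    {m₀ : ℤ} (h₀ : latticeSymbol b m₀ < 0) (hpos : ∀ m : ℤ, m ≠ 0 → m ≠ m₀ → 0 < latticeSymbol b m) :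
    FormDetPSD (shiftRecipe b) ↔ ∀ t : Finset ℤ, (∀ m ∈ t, m ≠ 0 ∧ m ≠ m₀) →
      |latticeSymbol b m₀| * ∑ m ∈ t, (m : ℝ) ^ 2 / latticeSymbol b m ≤ (m₀ : ℝ) ^ 2 := by
  refine ⟨fun h t ht => ?_, formDetPSD_shiftRecipe_of_pin_index hb hc h₀ hpos⟩
  by_contra hlt
  exact not_formDetPSD_of_pin_excess hb hc h₀ t (fun m hm => hpos m (ht m hm).1 (ht m hm).2) (not_le.1 hlt) h

/-- **The glued slot on the one-negative-mode stratum, IFF form** (`b_j ≠ 0`).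
[cite: Zhang2022LandauSiegel, Prop 7.1 p.44 with (7.2), (8.11)–(8.23); §12 (12.6)–(12.8); §18 (18.1)] -/
theorem gluedFormPSD_iff_pin_index (hb : Function.Injective b) (hb0 : ∀ j, b j ≠ 0)
    (hc : 0 < (∑ j : Fin 3, shiftW b j).re)
    {m₀ : ℤ} (h₀ : latticeSymbol b m₀ < 0) (hpos : ∀ m : ℤ, m ≠ 0 → m ≠ m₀ → 0 < latticeSymbol b m) :
    GluedFormPSD b ↔ ∀ t : Finset ℤ, (∀ m ∈ t, m ≠ 0 ∧ m ≠ m₀) →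
      |latticeSymbol b m₀| * ∑ m ∈ t, (m : ℝ) ^ 2 / latticeSymbol b m ≤ (m₀ : ℝ) ^ 2 := by
  refine ⟨fun h t ht => ?_, gluedFormPSD_of_pin_index hb hb0 hc h₀ hpos⟩
  by_contra hlt
  exact not_gluedFormPSD_of_pin_excess hb hc h₀ t (fun m hm => hpos m (ht m hm).1 (ht m hm).2) (not_le.1 hlt) h

/-- **On the one-negative-mode stratum the glued and the one-sided slot regions COINCIDE** (`b_j ≠ 0`, `c₀(b) > 0`).
[cite: Zhang2022LandauSiegel, Prop 7.1 p.44 with (7.2); §12 (12.6)–(12.8); §18 (18.1)] -/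
theorem gluedFormPSD_iff_formDetPSD_of_one_mode (hb : Function.Injective b) (hb0 : ∀ j, b j ≠ 0)
    (hc : 0 < (∑ j : Fin 3, shiftW b j).re)
    {m₀ : ℤ} (h₀ : latticeSymbol b m₀ < 0) (hpos : ∀ m : ℤ, m ≠ 0 → m ≠ m₀ → 0 < latticeSymbol b m) :
    GluedFormPSD b ↔ FormDetPSD (shiftRecipe b) := by
  rw [gluedFormPSD_iff_pin_index hb hb0 hc h₀ hpos, formDetPSD_shiftRecipe_iff_pin_index hb hc h₀ hpos]

end Schema

/-! ### Part 4 — the finitary slot-region criterion for every sorted positive triple with `c₀(b) > 0` -/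

section Criterion

variable {b : Fin 3 → ℝ}

/-- Under the one-sided slot a negative mode is ISOLATED: every other non-zero mode is positive (else
`Det.not_formDetPSD_of_two_modes`). [cite: Zhang2022LandauSiegel, §2 Lemma 2.3; Prop 7.1 p.44 with (7.2), (8.11)–(8.23)] -/
theorem latticeSymbol_pos_of_formDetPSD_of_neg (hb : Function.Injective b) (hc : 0 < (∑ j : Fin 3, shiftW b j).re)
    (h : FormDetPSD (shiftRecipe b)) {m₀ : ℤ} (h₀ : latticeSymbol b m₀ < 0) {m : ℤ} (hm : m ≠ 0) (hm₀ : m ≠ m₀) :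
    0 < latticeSymbol b m := by
  by_contra hle
  exact not_formDetPSD_of_two_modes hb hc (Ne.symm hm₀) hm h₀ (not_lt.1 hle) h

/-- **THE SLOT-REGION CRITERION, ONE-SIDED SLOT (finitary kernel form of GLUED-SLOT-REGION.md §1).** For a sorted positive
triple `0 < b₀ < b₁ < b₂` with `c₀(b) > 0`:
`Det.FormDetPSD (Det.shiftRecipe b) ↔ [∀ m, σ_b(m) ≥ 0] ∨ [∃ m₀, σ_b(m₀) < 0 ∧ (∀ m ∉ {0, m₀}, σ_b(m) > 0) ∧ finitary pin index ≤ 0]`.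
The first branch is Lemma 2.3's box (`Det.signAdmissible_iff_latticeSymbol_nonneg`; K5/K6
`Det.formDetPSD_shiftRecipe_of_signAdmissible`; zero modes allowed there, e.g. `b = (1,2,3)`); the second is the «N = 1
shell» (Part 3; no zero mode); `N ≥ 2` and «one negative + one zero mode» fail by `Det.not_formDetPSD_of_two_modes`, so no
separate «no zero mode» hypothesis is needed. The windowed slot `Det.DictShiftPSD b` is not this criterion's subject (K6/K8:
it holds iff the first branch). [cite: Zhang2022LandauSiegel, §2 Lemma 2.3; Prop 7.1 p.44 with (7.2), (8.11)–(8.23)] -/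
theorem formDetPSD_shiftRecipe_iff_modes (hb₀ : 0 < b 0) (h01 : b 0 < b 1) (h12 : b 1 < b 2)
    (hc : 0 < (∑ j : Fin 3, shiftW b j).re) :
    FormDetPSD (shiftRecipe b) ↔
      (∀ m : ℤ, 0 ≤ latticeSymbol b m) ∨
      (∃ m₀ : ℤ, latticeSymbol b m₀ < 0 ∧ (∀ m : ℤ, m ≠ 0 → m ≠ m₀ → 0 < latticeSymbol b m) ∧
        ∀ t : Finset ℤ, (∀ m ∈ t, m ≠ 0 ∧ m ≠ m₀) →
          |latticeSymbol b m₀| * ∑ m ∈ t, (m : ℝ) ^ 2 / latticeSymbol b m ≤ (m₀ : ℝ) ^ 2) := by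
  have hb := injective_of_sorted h01 h12
  constructor
  · intro h
    by_cases hN : ∀ m : ℤ, 0 ≤ latticeSymbol b m
    · exact Or.inl hN
    · obtain ⟨m₀, hm₀⟩ := not_forall.1 hN
      have h₀ : latticeSymbol b m₀ < 0 := not_le.1 hm₀
      have hpos : ∀ m : ℤ, m ≠ 0 → m ≠ m₀ → 0 < latticeSymbol b m :=
        fun m hm hm' => latticeSymbol_pos_of_formDetPSD_of_neg hb hc h h₀ hm hm'
      exact Or.inr ⟨m₀, h₀, hpos, (formDetPSD_shiftRecipe_iff_pin_index hb hc h₀ hpos).1 h⟩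
  · rintro (hN | ⟨m₀, h₀, hpos, hS⟩)
    · exact formDetPSD_shiftRecipe_of_signAdmissible
        ((signAdmissible_iff_latticeSymbol_nonneg b).2 ⟨hb₀, h01, h12, hN⟩)
    · exact formDetPSD_shiftRecipe_of_pin_index hb hc h₀ hpos hS

/-- **THE SLOT-REGION CRITERION, GLUED SLOT.** For a sorted positive triple with `c₀(b) > 0`, Family B's no-overlap glued
slot `Det.GluedFormPSD b` holds iff the SAME disjunction holds (box branch: `Det.gluedFormPSD_of_signAdmissible`, K6″).
[cite: Zhang2022LandauSiegel, §2 Lemma 2.3; Prop 7.1 p.44 with (7.2), (8.11)–(8.23); §12 (12.6)–(12.8); §18 (18.1)] -/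
theorem gluedFormPSD_iff_modes (hb₀ : 0 < b 0) (h01 : b 0 < b 1) (h12 : b 1 < b 2)
    (hc : 0 < (∑ j : Fin 3, shiftW b j).re) :
    GluedFormPSD b ↔
      (∀ m : ℤ, 0 ≤ latticeSymbol b m) ∨
      (∃ m₀ : ℤ, latticeSymbol b m₀ < 0 ∧ (∀ m : ℤ, m ≠ 0 → m ≠ m₀ → 0 < latticeSymbol b m) ∧
        ∀ t : Finset ℤ, (∀ m ∈ t, m ≠ 0 ∧ m ≠ m₀) →
          |latticeSymbol b m₀| * ∑ m ∈ t, (m : ℝ) ^ 2 / latticeSymbol b m ≤ (m₀ : ℝ) ^ 2) := by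
  have hb := injective_of_sorted h01 h12
  have hb0 : ∀ j, b j ≠ 0 := by
    intro j
    fin_cases j
    · exact hb₀.ne'
    · exact (hb₀.trans h01).ne'
    · exact ((hb₀.trans h01).trans h12).ne'
  constructor
  · intro h
    rcases (formDetPSD_shiftRecipe_iff_modes hb₀ h01 h12 hc).1 h.formDetPSD with hN | hone
    · exact Or.inl hN
    · exact Or.inr hone
  · rintro (hN | ⟨m₀, h₀, hpos, hS⟩)
    · exact gluedFormPSD_of_signAdmissible ((signAdmissible_iff_latticeSymbol_nonneg b).2 ⟨hb₀, h01, h12, hN⟩)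
    · exact gluedFormPSD_of_pin_index hb hb0 hc h₀ hpos hS

/-- **THE ONE-SIDED AND THE GLUED SLOT REGIONS ARE EQUAL on `{c₀ > 0}`:** for every sorted positive triple with
`c₀(b) > 0`, `Det.GluedFormPSD b ↔ Det.FormDetPSD (Det.shiftRecipe b)` (→ the slot hierarchy
`Det.GluedFormPSD.formDetPSD`; ← the criterion). Both regions strictly contain Lemma 2.3's box = the windowed slot region
(`Det.dictShiftPSD_iff_signAdmissible`, K8; witness `Det.offBoxTriple_three_slots`).
[cite: Zhang2022LandauSiegel, §2 Lemma 2.3; Prop 7.1 p.44 with (7.2); §12 (12.6)–(12.8); §18 (18.1)] -/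
theorem gluedFormPSD_iff_formDetPSD (hb₀ : 0 < b 0) (h01 : b 0 < b 1) (h12 : b 1 < b 2)
    (hc : 0 < (∑ j : Fin 3, shiftW b j).re) :
    GluedFormPSD b ↔ FormDetPSD (shiftRecipe b) := by
  rw [gluedFormPSD_iff_modes hb₀ h01 h12 hc, formDetPSD_shiftRecipe_iff_modes hb₀ h01 h12 hc]

end Criterion

end Det

end Literature.NumberTheory.LFunctions.Zhang2022

end
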